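/-
Copyright: the b2b-balaban T⁴-continuum CRUX team, row NE7b leaf lineage `t4-ne7b-formalise-leaf-06` (gen 150). Project licence.
-/
import Mathlib.Analysis.Complex.Liouville
import Mathlib.Analysis.Complex.RealDeriv
import Mathlib.Analysis.Calculus.FDeriv.Symmetric
import Mathlib.Analysis.Calculus.IteratedDeriv.Lemmas
import Mathlib.Analysis.Calculus.Deriv.Mul

/-!
# THE HESSIAN LETTER FROM ANALYTICITY: a functional holomorphic and bounded by `M` on a complex `δ`-neighbourhood has a real
# part whose Hessian is two-sidedly small — `|D²(Re E)(p)[z,z]| ≤ (2M∕δ²)‖z‖²`, `|D²(Re E)(p)[z,w]| ≤ (4M∕δ²)‖z‖‖w‖` — Cauchy's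
# inequality on complex lines (row NE7b, node U5c; the SUPPLIER of the convexity road's displayed Hessian-smallness letters `h`,
# `ε`, `c` from the currency print states its effective actions in)

Cell `pub-balaban`, sub-cell `t4`, spine estimate NE7b (`T4WeightBudget.RelWeightBound`; the cell's OWN estimate — NOT PRINTED in
[Bałaban 1983–89], NOT PROVED).  Crux-route work under `Spine/NE7b/` by a row leaf on the convexity road; NOTHING of Bałaban's is
named, valued or asserted; no `T4Continuum/Support` leaf typed; no `def`; zero `sorry`.  Imports: Mathlib only — independent of the
hub's olean frontier.

WHY.  Every socket of the windowed convexity road DISPLAYS a Hessian-smallness letter for the anharmonic part of the exponent and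
leaves its supply to «the instance» ((A3) ∕ (A1c), NC-NE7b-α UNRULED): `…ConvexWindowSuppliers.firstOrderOn_quadratic_add_of_hessianOn`
(`∀ x ∈ K, ∀ v, −h‖v‖² ≤ D²P(x)[v,v]`), `…HessianLocality` (per-term `|D²P_p(x)[v,v]| ≤ c·Σ_{i ∈ S_p} v_i²`), `…ConvexWindowVirialSocket`
(`P ∈ C²`, Hessian `≥ −h` ON `K`), the sibling `…PerturbedGaussianFibre` (leaf-05, staged: `|D²P(p)[w,w′]| ≤ ‖w‖‖w′‖`, «by VALUE nothing:
`ε ↔` print's `‖D²E_k⁺‖` on `𝓡_k` via Cauchy bounds is (A3)», journal l.56745), leaf-01's `…HessianChartTransport` (the gradient letter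
`g`).  The currency in which print and the template STATE their effective actions is not a Hessian bound but ANALYTICITY WITH A SUP BOUND
ON A COMPLEX NEIGHBOURHOOD of the small-field region (read BY SHAPE only, nothing asserted: [B12] = Bałaban, CMP 109 (1987) §1, the
spaces of analytic functions of the complexified fields with `|Im|`-type radii; Dimock's template I §4 (184)–(209), `E_k⁺` analytic and
`O(1)`-bounded on `𝓡_k`).  The passage between the two currencies is Cauchy's inequality on complex lines — one sup bound buys every
derivative, the `k`-th at the price `k!·M∕δᵏ`.  THIS FILE types that passage for `k = 2`, so that the road's Hessian letters are owed
in print's own currency `(M, δ)`: `h = ε = 2M∕δ²` per unit direction, `4M∕δ²` for mixed directions.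

WHAT IS PROVED ([folklore]: Cauchy's inequalities [Hörmander 1973, Thm 2.2.7] — Mathlib's
`Complex.norm_iteratedDeriv_le_of_forall_mem_sphere_norm_le` BY NAME — plus the chain rule along real lines and polarization):
* §1 ONE COMPLEX VARIABLE, REAL TRACE: for `g` holomorphic on an open `S ⊆ ℂ`, the real function `s ↦ Re g(s)` has
  `deriv = Re g′` (`deriv_re_ofReal`) and `iteratedDeriv 2 = Re g″` (`iteratedDeriv_two_re_ofReal`) at real points of `S`; with
  `closedBall s₀ r ⊆ S` and `‖g‖ ≤ M` on the circle: `|(Re g)″(s₀)| ≤ 2M∕r²` (`abs_iteratedDeriv_two_re_le`).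
* §2 LINE SLICES (any real normed space `V`, `P : V → ℝ` of class `C²` on an open `O ∋ x`): `iteratedDeriv_two_lineSlice`
  (`(s ↦ P(x + s v))″(0) = D²P(x)[v,v]` in `fderiv ∘ fderiv` currency); THE MECHANISM **`abs_hessian_le_of_holomorphicSlice`**: if the
  slice is the real trace of a `g` holomorphic on an open `S ⊇ closedBall 0 r` with `‖g‖ ≤ M` on `|t| = r`, then `|D²P(x)[v,v]| ≤ 2M∕r²`.
* §3 THROUGH A REAL-LINEAR CHART `J : V →L[ℝ] W` into a complex normed space (`P y = Re E(J y)`, `E` of class `C²` over `ℂ` on an open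
  `U ⊆ W`, `‖E‖ ≤ M` on `U`): `contDiffOn_re` ∕ `contDiffOn_re_comp` (the road's regularity letter `P ∈ Cⁿ` on `J⁻¹ U` from `E ∈ Cⁿ`);
  `abs_hessian_chart_le_of_disc` (`|D²P(x)[v,v]| ≤ 2M∕r²` once the closed complex disc `{J x + t·J v : |t| ≤ r}` lies in `U` — ANY `J`);
  and for a CONTRACTIVE chart (`‖J v‖ ≤ ‖v‖` — norm-preserving complexifications, and `ℓ²`-fields into `ℓ^∞` ones) with `closedBall (J x) δ ⊆ U`: **`abs_hessian_chart_le`** (`≤ (2M∕δ²)‖v‖²`),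
  **`abs_hessian_chart_mixed_le`** (`|D²P(x)[v,w]| ≤ (4M∕δ²)‖v‖‖w‖`, by symmetry of `D²P` and polarization at equal norms), the
  diagonal in `iteratedFDeriv ℝ 2 P x ![v, v]` currency, and the road's window letters **`hessianOn_chart_twoSided`**
  (`∀ x ∈ K, ∀ v, −(2M∕δ²)‖v‖² ≤ D²P(x)[v,v] ≤ (2M∕δ²)‖v‖²` once `closedBall (J x) δ ⊆ U` for `x ∈ K`) ∕ `hessianOn_chart_mixed`.
* §4 ON THE COMPLEX SPACE ITSELF (`J = id`, `P̃ q = Re E(q)`, any `p` with `closedBall p δ ⊆ U`): `abs_hessian_re_le`,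
  `abs_hessian_re_mixed_le`, `hessianOn_re_twoSided`.
* §5 LATTICE FIELDS (`V = ι → ℝ`, `W = ι → ℂ`, componentwise complexification, SUP norms — so `closedBall (↑x) δ` IS the polydisc
  `{z : |z i − x i| ≤ δ ∀ i}`): `norm_ofReal_pi` (the chart preserves the sup norm), **`abs_hessian_lattice_le`**,
  **`abs_hessian_lattice_mixed_le`**, **`hessianOn_lattice_twoSided`** — the letters for `y ↦ Re E(↑y)` verbatim in `‖v‖_∞`.
* §6 a toy (`E z = z²` on `ball 0 2 ⊆ ℂ`, `M = 4`, `δ = 1`: the hypotheses are jointly inhabited and the bound reads `|·| ≤ 8‖z‖²`).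

NOT HERE (honest): the GLOBAL `C²` letter some sockets display (`ContDiff ℝ 2 P` on the whole space — a cutoff ∕ extension matter; this
file delivers `ContDiffOn` on `J⁻¹ U` and the letters ON the real window); non-isometric charts beyond §3's disc form (use §4 on `W` and
the consumer's chain rule); gradients (`M∕δ`) and higher derivatives (`k!·M∕δᵏ`) — the same mechanism with `n ≠ 2`; WHICH functional of print is analytic on WHICH complex
neighbourhood with WHICH `(M, δ)` — the (A3) ∕ (A1c) readings, NC-NE7b-α UNRULED; anything of Bałaban's.  BY-NAME EFFECT ON THE WALL:
NONE (a supplier for displayed letters).  NE7b NOT PRINTED ∕ NOT PROVED; spine PROVED 0∕9; rung (B)+1 on a FINITE torus — NOT infinite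
volume, NOT the mass gap, NOT Clay.
HONEST DEPENDENCY: continuum YM on T⁴ ⇐ BetaPertH ∧ nine spine estimates (0/9 proved); BetaPertH ⇐ (D1) ∧ (D4) ∧ CAP+tail.
-/

set_option autoImplicit false

open Set Filter Metric Topology

namespace Summit.QuantumFields.BalabanUV.T4Continuum.NE7b.AnalyticHessianLetter

/-! ## §1 One complex variable: the real trace of a holomorphic function and Cauchy's inequality -/

section OneVariable

variable {g : ℂ → ℂ} {S : Set ℂ}

/-- Near a real parameter whose complex image lies in the open set `S`, the real parameters stay in `S`. [folklore] -/
theorem eventually_ofReal_mem (hS : IsOpen S) {s₀ : ℝ} (h0 : (s₀ : ℂ) ∈ S) : ∀ᶠ s : ℝ in 𝓝 s₀, (s : ℂ) ∈ S :=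
  Complex.continuous_ofReal.continuousAt.preimage_mem_nhds (hS.mem_nhds h0)

/-- The real trace `s ↦ Re g(s)` of a function holomorphic on an open `S` is differentiable at the real points of `S`, with
derivative `Re g′(s)`. [folklore] -/
theorem hasDerivAt_re_ofReal (hS : IsOpen S) (hg : DifferentiableOn ℂ g S) {s : ℝ} (hs : (s : ℂ) ∈ S) :
    HasDerivAt (fun s : ℝ => (g s).re) (deriv g s).re s :=
  ((hg.differentiableAt (hS.mem_nhds hs)).hasDerivAt).real_of_complex

/-- `(Re g)′(s) = Re g′(s)` at the real points of `S`. [folklore] -/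
theorem deriv_re_ofReal (hS : IsOpen S) (hg : DifferentiableOn ℂ g S) {s : ℝ} (hs : (s : ℂ) ∈ S) :
    deriv (fun s : ℝ => (g s).re) s = (deriv g s).re :=
  (hasDerivAt_re_ofReal hS hg hs).deriv

/-- `(Re g)″(s₀) = Re g″(s₀)` at the real points of `S` (the derivative `g′` is again holomorphic on `S`). [folklore] -/
theorem iteratedDeriv_two_re_ofReal (hS : IsOpen S) (hg : DifferentiableOn ℂ g S) {s₀ : ℝ} (h0 : (s₀ : ℂ) ∈ S) :
    iteratedDeriv 2 (fun s : ℝ => (g s).re) s₀ = (iteratedDeriv 2 g s₀).re := by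
  have hd1 : deriv (fun s : ℝ => (g s).re) =ᶠ[𝓝 s₀] fun s => (deriv g s).re :=
    (eventually_ofReal_mem hS h0).mono fun s hs => deriv_re_ofReal hS hg hs
  have hg' : DifferentiableAt ℂ (deriv g) s₀ := ((hg.analyticOnNhd hS).deriv s₀ h0).differentiableAt
  have h2 : HasDerivAt (fun s : ℝ => (deriv g s).re) (deriv (deriv g) s₀).re s₀ := hg'.hasDerivAt.real_of_complex
  have e1 : iteratedDeriv 2 (fun s : ℝ => (g s).re) = deriv (deriv fun s : ℝ => (g s).re) := by
    rw [iteratedDeriv_succ, iteratedDeriv_one]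
  have e2 : iteratedDeriv 2 g = deriv (deriv g) := by rw [iteratedDeriv_succ, iteratedDeriv_one]
  rw [e1, e2, hd1.deriv_eq, h2.deriv]

/-- **CAUCHY'S INEQUALITY, SECOND DERIVATIVE**: `g` holomorphic on an open `S ⊇ closedBall c r`, `‖g‖ ≤ M` on the circle `|t − c| = r`
⟹ `‖g″(c)‖ ≤ 2M∕r²` (Mathlib's `Complex.norm_iteratedDeriv_le_of_forall_mem_sphere_norm_le` BY NAME). [folklore] -/
theorem norm_iteratedDeriv_two_le (hg : DifferentiableOn ℂ g S) {c : ℂ} {r M : ℝ} (hr : 0 < r) (hsub : closedBall c r ⊆ S)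
    (hM : ∀ t ∈ sphere c r, ‖g t‖ ≤ M) : ‖iteratedDeriv 2 g c‖ ≤ 2 * M / r ^ 2 := by
  simpa [Nat.factorial] using Complex.norm_iteratedDeriv_le_of_forall_mem_sphere_norm_le 2 hr (hg.diffContOnCl_ball hsub) hM

/-- **THE REAL TRACE INHERITS CAUCHY'S BOUND**: `|(Re g)″(s₀)| ≤ 2M∕r²` for `g` holomorphic on an open `S ⊇ closedBall s₀ r` with
`‖g‖ ≤ M` on the circle. [folklore] -/
theorem abs_iteratedDeriv_two_re_le (hS : IsOpen S) (hg : DifferentiableOn ℂ g S) {s₀ : ℝ} {r M : ℝ} (hr : 0 < r)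
    (hsub : closedBall (s₀ : ℂ) r ⊆ S) (hM : ∀ t ∈ sphere (s₀ : ℂ) r, ‖g t‖ ≤ M) :
    |iteratedDeriv 2 (fun s : ℝ => (g s).re) s₀| ≤ 2 * M / r ^ 2 := by
  rw [iteratedDeriv_two_re_ofReal hS hg (hsub (mem_closedBall_self hr.le))]
  exact (Complex.abs_re_le_norm _).trans (norm_iteratedDeriv_two_le hg hr hsub hM)

end OneVariable

/-! ## §2 Line slices of a `C²` function on a real normed space, and THE MECHANISM -/

section LineSlice

variable {V : Type*} [NormedAddCommGroup V] [NormedSpace ℝ V] {F : Type*} [NormedAddCommGroup F] [NormedSpace ℝ F]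

/-- The slice `s ↦ P(x + s v)` has derivative `DP(x + s v)[v]`. [folklore] -/
theorem hasDerivAt_lineSlice {P : V → F} {x v : V} {s : ℝ} {P' : V →L[ℝ] F} (h : HasFDerivAt P P' (x + s • v)) :
    HasDerivAt (fun s : ℝ => P (x + s • v)) (P' v) s := by
  have hl : HasDerivAt (fun s : ℝ => x + s • v) v s := by
    simpa using ((hasDerivAt_id s).smul_const v).const_add x
  exact h.comp_hasDerivAt s hl

/-- Along a slice through a point of an open set, the parameters near `0` stay in the set. [folklore] -/
theorem eventually_lineSlice_mem {O : Set V} (hO : IsOpen O) {x : V} (hx : x ∈ O) (v : V) :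
    ∀ᶠ s : ℝ in 𝓝 0, x + s • v ∈ O :=
  (by fun_prop : Continuous fun s : ℝ => x + s • v).continuousAt.preimage_mem_nhds (hO.mem_nhds (by simpa using hx))

/-- **`(s ↦ P(x + s v))″(0) = D²P(x)[v,v]`** (in `fderiv ∘ fderiv` currency) for `P` of class `C²` on an open `O ∋ x`. [folklore] -/
theorem iteratedDeriv_two_lineSlice {P : V → F} {O : Set V} (hO : IsOpen O) (hP : ContDiffOn ℝ 2 P O) {x : V} (hx : x ∈ O)
    (v : V) : iteratedDeriv 2 (fun s : ℝ => P (x + s • v)) 0 = fderiv ℝ (fderiv ℝ P) x v v := by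
  have hd : DifferentiableOn ℝ P O := hP.differentiableOn two_ne_zero
  have hd' : DifferentiableOn ℝ (fderiv ℝ P) O := (hP.fderiv_of_isOpen hO (m := 1) le_rfl).differentiableOn one_ne_zero
  have h1 : deriv (fun s : ℝ => P (x + s • v)) =ᶠ[𝓝 0] fun s => fderiv ℝ P (x + s • v) v :=
    (eventually_lineSlice_mem hO hx v).mono fun s hs =>
      (hasDerivAt_lineSlice ((hd.differentiableAt (hO.mem_nhds hs)).hasFDerivAt)).deriv
  have hG : HasFDerivAt (fderiv ℝ P) (fderiv ℝ (fderiv ℝ P) x) (x + (0 : ℝ) • v) := by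
    simpa using (hd'.differentiableAt (hO.mem_nhds hx)).hasFDerivAt
  have h2 : HasDerivAt (fun s : ℝ => fderiv ℝ P (x + s • v) v) (fderiv ℝ (fderiv ℝ P) x v v) 0 := by
    simpa using (hasDerivAt_lineSlice hG).clm_apply (hasDerivAt_const (0 : ℝ) v)
  have e1 : iteratedDeriv 2 (fun s : ℝ => P (x + s • v)) = deriv (deriv fun s : ℝ => P (x + s • v)) := by
    rw [iteratedDeriv_succ, iteratedDeriv_one]
  rw [e1, h1.deriv_eq, h2.deriv]

/-- **THE CAUCHY MECHANISM FOR ONE DIRECTION.**  `P : V → ℝ` is `C²` on an open `O ∋ x`; along `v` its slice is the real trace of a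
function `g` holomorphic on an open `S ⊇ closedBall 0 r` — `P(x + s v) = Re g(s)` for real `s` with `↑s ∈ S` — and `‖g‖ ≤ M` on the
circle `|t| = r`.  Then `|D²P(x)[v,v]| ≤ 2M∕r²`. [folklore] -/
theorem abs_hessian_le_of_holomorphicSlice {P : V → ℝ} {O : Set V} (hO : IsOpen O) (hP : ContDiffOn ℝ 2 P O) {x : V}
    (hx : x ∈ O) {v : V} {g : ℂ → ℂ} {S : Set ℂ} (hS : IsOpen S) (hg : DifferentiableOn ℂ g S) {r M : ℝ} (hr : 0 < r)
    (hsub : closedBall (0 : ℂ) r ⊆ S) (hM : ∀ t ∈ sphere (0 : ℂ) r, ‖g t‖ ≤ M)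
    (hslice : ∀ s : ℝ, (s : ℂ) ∈ S → P (x + s • v) = (g s).re) :
    |fderiv ℝ (fderiv ℝ P) x v v| ≤ 2 * M / r ^ 2 := by
  rw [← iteratedDeriv_two_lineSlice hO hP hx v]
  have h0 : ((0 : ℝ) : ℂ) ∈ S := by simpa using hsub (mem_closedBall_self hr.le)
  have heq : (fun s : ℝ => P (x + s • v)) =ᶠ[𝓝 0] fun s => (g s).re :=
    (eventually_ofReal_mem hS h0).mono fun s hs => hslice s hs
  rw [heq.iteratedDeriv_eq]
  exact abs_iteratedDeriv_two_re_le hS hg hr (by simpa using hsub) (by simpa using hM)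

end LineSlice

/-! ## §3 Through a real-linear chart into a complex normed space: `P y = Re E(J y)` -/

section Chart

variable {V : Type*} [NormedAddCommGroup V] [NormedSpace ℝ V] {W : Type*} [NormedAddCommGroup W] [NormedSpace ℂ W]
  {E : W → ℂ} {U : Set W} {M : ℝ}

/-- **REGULARITY LETTER on the complex space**: `E` of class `Cⁿ` over `ℂ` on `U` ⟹ `Re E` of class `Cⁿ` over `ℝ` on `U`. [folklore] -/
theorem contDiffOn_re {n : WithTop ℕ∞} (hE : ContDiffOn ℂ n E U) : ContDiffOn ℝ n (fun q => (E q).re) U :=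
  Complex.reCLM.contDiff.comp_contDiffOn (hE.restrict_scalars ℝ)

/-- **REGULARITY LETTER through a chart**: `P y = Re E(J y)` is of class `Cⁿ` over `ℝ` on the open real preimage `J⁻¹ U`. [folklore] -/
theorem contDiffOn_re_comp (J : V →L[ℝ] W) {n : WithTop ℕ∞} (hE : ContDiffOn ℂ n E U) :
    ContDiffOn ℝ n (fun y => (E (J y)).re) (J ⁻¹' U) :=
  (contDiffOn_re hE).comp J.contDiff.contDiffOn (mapsTo_preimage _ _)

/-- The parameters of a complex line meeting the open set `U` form an open set. [folklore] -/
theorem isOpen_slice (hU : IsOpen U) (p z : W) : IsOpen ((fun t : ℂ => p + t • z) ⁻¹' U) :=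
  hU.preimage (by fun_prop)

/-- The restriction of a holomorphic `E` to a complex line is holomorphic where the line meets `U`. [folklore] -/
theorem differentiableOn_slice (hE : DifferentiableOn ℂ E U) (p z : W) :
    DifferentiableOn ℂ (fun t : ℂ => E (p + t • z)) ((fun t : ℂ => p + t • z) ⁻¹' U) :=
  hE.comp ((differentiable_const p).add (differentiable_id.smul_const z)).differentiableOn (mapsTo_preimage _ _)

/-- **HESSIAN LETTER ALONG ONE DIRECTION, ANY CHART**: `E ∈ C²(U)` over `ℂ`, `‖E‖ ≤ M` on `U`, and the closed complex disc
`{J x + t·J v : |t| ≤ r}` inside `U` ⟹ `|D²P(x)[v,v]| ≤ 2M∕r²` for `P y = Re E(J y)`. [folklore] -/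
theorem abs_hessian_chart_le_of_disc (J : V →L[ℝ] W) (hU : IsOpen U) (hE : ContDiffOn ℂ 2 E U) (hM : ∀ q ∈ U, ‖E q‖ ≤ M)
    {x v : V} {r : ℝ} (hr : 0 < r) (hsub : ∀ t : ℂ, ‖t‖ ≤ r → J x + t • J v ∈ U) :
    |fderiv ℝ (fderiv ℝ (fun y => (E (J y)).re)) x v v| ≤ 2 * M / r ^ 2 := by
  have hx : x ∈ J ⁻¹' U := by simpa using hsub 0 (by simpa using hr.le)
  refine abs_hessian_le_of_holomorphicSlice (hU.preimage J.continuous) (contDiffOn_re_comp J hE) hx (isOpen_slice hU (J x) (J v))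
    (differentiableOn_slice (hE.differentiableOn two_ne_zero) (J x) (J v)) hr ?_ ?_ ?_
  · intro t ht
    exact hsub t (by simpa using ht)
  · intro t ht
    exact hM _ (hsub t (le_of_eq (by simpa using ht)))
  · intro s _
    simp [map_add, map_smul]

/-- A contractive chart (`‖J v‖ ≤ ‖v‖`) sends `J x + t·J v`, `|t| ≤ δ∕‖v‖`, into the closed `δ`-ball about `J x`. [folklore] -/
theorem chart_disc_subset (J : V →L[ℝ] W) (hJ : ∀ v, ‖J v‖ ≤ ‖v‖) {x v : V} {δ : ℝ} (hv : 0 < ‖v‖)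
    (hsub : closedBall (J x) δ ⊆ U) : ∀ t : ℂ, ‖t‖ ≤ δ / ‖v‖ → J x + t • J v ∈ U := by
  intro t ht
  apply hsub
  rw [mem_closedBall, dist_eq_norm, add_sub_cancel_left, norm_smul]
  calc ‖t‖ * ‖J v‖ ≤ δ / ‖v‖ * ‖v‖ := mul_le_mul ht (hJ v) (norm_nonneg _) ((norm_nonneg t).trans ht)
    _ = δ := div_mul_cancel₀ δ hv.ne'

/-- **HESSIAN LETTER, DIAGONAL** (contractive chart `‖J v‖ ≤ ‖v‖`, `closedBall (J x) δ ⊆ U`): `|D²P(x)[v,v]| ≤ (2M∕δ²)‖v‖²`. [folklore] -/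
theorem abs_hessian_chart_le (J : V →L[ℝ] W) (hJ : ∀ v, ‖J v‖ ≤ ‖v‖) (hU : IsOpen U) (hE : ContDiffOn ℂ 2 E U)
    (hM : ∀ q ∈ U, ‖E q‖ ≤ M) {x : V} {δ : ℝ} (hδ : 0 < δ) (hsub : closedBall (J x) δ ⊆ U) (v : V) :
    |fderiv ℝ (fderiv ℝ (fun y => (E (J y)).re)) x v v| ≤ 2 * M / δ ^ 2 * ‖v‖ ^ 2 := by
  by_cases hv : v = 0
  · subst hv
    simp
  have hvn : 0 < ‖v‖ := norm_pos_iff.mpr hv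
  have h := abs_hessian_chart_le_of_disc J hU hE hM (div_pos hδ hvn) (chart_disc_subset J hJ hvn hsub)
  calc |fderiv ℝ (fderiv ℝ (fun y => (E (J y)).re)) x v v| ≤ 2 * M / (δ / ‖v‖) ^ 2 := h
    _ = 2 * M / δ ^ 2 * ‖v‖ ^ 2 := by field_simp

/-- **HESSIAN LETTER, MIXED** (contractive chart `‖J v‖ ≤ ‖v‖`, `closedBall (J x) δ ⊆ U`): `|D²P(x)[v,w]| ≤ (4M∕δ²)‖v‖‖w‖` — symmetry of the
second derivative of a `C²` function and polarization `4·D²P[v,w] = D²P[v+w,v+w] − D²P[v−w,v−w]` at equal norms, then rescaling. [folklore] -/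
theorem abs_hessian_chart_mixed_le (J : V →L[ℝ] W) (hJ : ∀ v, ‖J v‖ ≤ ‖v‖) (hU : IsOpen U) (hE : ContDiffOn ℂ 2 E U)
    (hM : ∀ q ∈ U, ‖E q‖ ≤ M) {x : V} {δ : ℝ} (hδ : 0 < δ) (hsub : closedBall (J x) δ ⊆ U) (v w : V) :
    |fderiv ℝ (fderiv ℝ (fun y => (E (J y)).re)) x v w| ≤ 4 * M / δ ^ 2 * ‖v‖ * ‖w‖ := by
  set B := fderiv ℝ (fderiv ℝ (fun y => (E (J y)).re)) x with hB
  have hx : x ∈ J ⁻¹' U := hsub (mem_closedBall_self hδ.le)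
  have hM0 : 0 ≤ M := (norm_nonneg _).trans (hM _ hx)
  have hsymm : ∀ a b, B a b = B b a := fun a b =>
    (((contDiffOn_re_comp J hE).contDiffAt ((hU.preimage J.continuous).mem_nhds hx)).isSymmSndFDerivAt (by simp)) a b
  have hdiag : ∀ a, |B a a| ≤ 2 * M / δ ^ 2 * ‖a‖ ^ 2 := abs_hessian_chart_le J hJ hU hE hM hδ hsub
  have hpol : ∀ a b, 4 * B a b = B (a + b) (a + b) - B (a - b) (a - b) := by
    intro a b
    simp only [map_add, map_sub, _root_.add_apply, _root_.sub_apply, hsymm b a]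
    ring
  -- equal norms
  have key : ∀ a b, ‖a‖ = ‖b‖ → |B a b| ≤ 4 * M / δ ^ 2 * ‖a‖ * ‖b‖ := by
    intro a b hab
    have h1 := (hdiag (a + b)).trans
      (mul_le_mul_of_nonneg_left (pow_le_pow_left₀ (norm_nonneg _) (norm_add_le a b) 2) (by positivity))
    have h2 := (hdiag (a - b)).trans
      (mul_le_mul_of_nonneg_left (pow_le_pow_left₀ (norm_nonneg _) (norm_sub_le a b) 2) (by positivity))
    have h4 : |4 * B a b| ≤ 2 * M / δ ^ 2 * (‖a‖ + ‖b‖) ^ 2 + 2 * M / δ ^ 2 * (‖a‖ + ‖b‖) ^ 2 := by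
      rw [hpol]
      exact (abs_sub _ _).trans (add_le_add h1 h2)
    rw [abs_mul, abs_of_pos (by norm_num : (0 : ℝ) < 4), hab] at h4
    rw [hab]
    have e : 2 * M / δ ^ 2 * (‖b‖ + ‖b‖) ^ 2 + 2 * M / δ ^ 2 * (‖b‖ + ‖b‖) ^ 2 = 4 * (4 * M / δ ^ 2 * ‖b‖ * ‖b‖) := by
      ring
    linarith [h4, e]
  by_cases hv : v = 0
  · simp [hv]
  by_cases hw : w = 0
  · simp [hw]
  have hvn : 0 < ‖v‖ := norm_pos_iff.mpr hv
  have hwn : 0 < ‖w‖ := norm_pos_iff.mpr hw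
  set c : ℝ := ‖v‖ / ‖w‖ with hc
  have hc0 : 0 < c := div_pos hvn hwn
  have hnorm : ‖v‖ = ‖c • w‖ := by
    rw [norm_smul, Real.norm_of_nonneg hc0.le, hc, div_mul_cancel₀ _ hwn.ne']
  have h := key v (c • w) hnorm
  rw [map_smul, smul_eq_mul, abs_mul, abs_of_pos hc0, ← hnorm] at h
  have h' : c * |B v w| ≤ c * (4 * M / δ ^ 2 * ‖v‖ * ‖w‖) := by
    calc c * |B v w| ≤ 4 * M / δ ^ 2 * ‖v‖ * ‖v‖ := h
      _ = c * (4 * M / δ ^ 2 * ‖v‖ * ‖w‖) := by rw [hc]; field_simp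
  exact le_of_mul_le_mul_left h' hc0

/-- **HESSIAN LETTER, DIAGONAL, `iteratedFDeriv` CURRENCY** (the shape of `…ConvexWindowSuppliers` ∕ `…HessianLocality`):
`|iteratedFDeriv ℝ 2 P x ![v, v]| ≤ (2M∕δ²)‖v‖²`. [folklore] -/
theorem abs_iteratedFDeriv_two_chart_le (J : V →L[ℝ] W) (hJ : ∀ v, ‖J v‖ ≤ ‖v‖) (hU : IsOpen U) (hE : ContDiffOn ℂ 2 E U)
    (hM : ∀ q ∈ U, ‖E q‖ ≤ M) {x : V} {δ : ℝ} (hδ : 0 < δ) (hsub : closedBall (J x) δ ⊆ U) (v : V) :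
    |iteratedFDeriv ℝ 2 (fun y => (E (J y)).re) x ![v, v]| ≤ 2 * M / δ ^ 2 * ‖v‖ ^ 2 := by
  rw [iteratedFDeriv_two_apply]
  exact abs_hessian_chart_le J hJ hU hE hM hδ hsub v

/-- **THE ROAD's WINDOW LETTER (two-sided Hessian display ON a real window `K`)**: if the closed complex `δ`-ball about every chart
image `J x`, `x ∈ K`, lies in `U`, then `∀ x ∈ K, ∀ v, −(2M∕δ²)‖v‖² ≤ D²P(x)[v,v] ≤ (2M∕δ²)‖v‖²` — the `hessianOn` letter of
`…ConvexWindowSuppliers.firstOrderOn_quadratic_add_of_hessianOn` with `h = 2M∕δ²`, and its upper companion. [folklore] -/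
theorem hessianOn_chart_twoSided (J : V →L[ℝ] W) (hJ : ∀ v, ‖J v‖ ≤ ‖v‖) (hU : IsOpen U) (hE : ContDiffOn ℂ 2 E U)
    (hM : ∀ q ∈ U, ‖E q‖ ≤ M) {K : Set V} {δ : ℝ} (hδ : 0 < δ) (hK : ∀ x ∈ K, closedBall (J x) δ ⊆ U) :
    ∀ x ∈ K, ∀ v : V, -(2 * M / δ ^ 2) * ‖v‖ ^ 2 ≤ iteratedFDeriv ℝ 2 (fun y => (E (J y)).re) x ![v, v] ∧
      iteratedFDeriv ℝ 2 (fun y => (E (J y)).re) x ![v, v] ≤ 2 * M / δ ^ 2 * ‖v‖ ^ 2 := by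
  intro x hx v
  have h := abs_le.mp (abs_iteratedFDeriv_two_chart_le J hJ hU hE hM hδ (hK x hx) v)
  constructor <;> linarith [h.1, h.2]

/-- **THE ROAD's MIXED WINDOW LETTER**: `∀ x ∈ K, ∀ v w, |D²P(x)[v,w]| ≤ (4M∕δ²)‖v‖‖w‖` (in `fderiv ∘ fderiv` currency — the shape
of the sibling `…PerturbedGaussianFibre`'s `hP2` and of `…FibreWindowHessianBounds` §8's mixed block, ON the window). [folklore] -/
theorem hessianOn_chart_mixed (J : V →L[ℝ] W) (hJ : ∀ v, ‖J v‖ ≤ ‖v‖) (hU : IsOpen U) (hE : ContDiffOn ℂ 2 E U)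
    (hM : ∀ q ∈ U, ‖E q‖ ≤ M) {K : Set V} {δ : ℝ} (hδ : 0 < δ) (hK : ∀ x ∈ K, closedBall (J x) δ ⊆ U) :
    ∀ x ∈ K, ∀ v w : V, |fderiv ℝ (fderiv ℝ (fun y => (E (J y)).re)) x v w| ≤ 4 * M / δ ^ 2 * ‖v‖ * ‖w‖ :=
  fun x hx v w => abs_hessian_chart_mixed_le J hJ hU hE hM hδ (hK x hx) v w

end Chart

/-! ## §4 On the complex space itself: `P̃ q = Re E(q)` (the chart `J = id`) -/

section Self

variable {W : Type*} [NormedAddCommGroup W] [NormedSpace ℂ W] {E : W → ℂ} {U : Set W} {M : ℝ}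

/-- **HESSIAN LETTER ON `W`, DIAGONAL**: `E ∈ C²(U)` over `ℂ`, `‖E‖ ≤ M` on `U`, `closedBall p δ ⊆ U` ⟹
`|D²(Re E)(p)[z,z]| ≤ (2M∕δ²)‖z‖²` (derivatives over `ℝ`). [folklore] -/
theorem abs_hessian_re_le (hU : IsOpen U) (hE : ContDiffOn ℂ 2 E U) (hM : ∀ q ∈ U, ‖E q‖ ≤ M) {p : W} {δ : ℝ} (hδ : 0 < δ)
    (hsub : closedBall p δ ⊆ U) (z : W) : |fderiv ℝ (fderiv ℝ (fun q => (E q).re)) p z z| ≤ 2 * M / δ ^ 2 * ‖z‖ ^ 2 :=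
  abs_hessian_chart_le (ContinuousLinearMap.id ℝ W) (fun _ => le_rfl) hU hE hM hδ (by simpa using hsub) z

/-- **HESSIAN LETTER ON `W`, MIXED**: `|D²(Re E)(p)[z,w]| ≤ (4M∕δ²)‖z‖‖w‖`. [folklore] -/
theorem abs_hessian_re_mixed_le (hU : IsOpen U) (hE : ContDiffOn ℂ 2 E U) (hM : ∀ q ∈ U, ‖E q‖ ≤ M) {p : W} {δ : ℝ}
    (hδ : 0 < δ) (hsub : closedBall p δ ⊆ U) (z w : W) :
    |fderiv ℝ (fderiv ℝ (fun q => (E q).re)) p z w| ≤ 4 * M / δ ^ 2 * ‖z‖ * ‖w‖ :=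
  abs_hessian_chart_mixed_le (ContinuousLinearMap.id ℝ W) (fun _ => le_rfl) hU hE hM hδ (by simpa using hsub) z w

/-- **WINDOW LETTER ON `W`**: `closedBall p δ ⊆ U` for `p ∈ K` ⟹ the two-sided display
`−(2M∕δ²)‖z‖² ≤ iteratedFDeriv ℝ 2 (Re E) p ![z, z] ≤ (2M∕δ²)‖z‖²` on `K`. [folklore] -/
theorem hessianOn_re_twoSided (hU : IsOpen U) (hE : ContDiffOn ℂ 2 E U) (hM : ∀ q ∈ U, ‖E q‖ ≤ M) {K : Set W} {δ : ℝ}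
    (hδ : 0 < δ) (hK : ∀ p ∈ K, closedBall p δ ⊆ U) :
    ∀ p ∈ K, ∀ z : W, -(2 * M / δ ^ 2) * ‖z‖ ^ 2 ≤ iteratedFDeriv ℝ 2 (fun q => (E q).re) p ![z, z] ∧
      iteratedFDeriv ℝ 2 (fun q => (E q).re) p ![z, z] ≤ 2 * M / δ ^ 2 * ‖z‖ ^ 2 :=
  hessianOn_chart_twoSided (ContinuousLinearMap.id ℝ W) (fun _ => le_rfl) hU hE hM hδ (by simpa using hK)

end Self

/-! ## §5 Lattice fields: `V = ι → ℝ`, `W = ι → ℂ`, componentwise complexification, sup norms (closed balls are polydiscs) -/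

section Lattice

variable {ι : Type*} [Fintype ι] {E : (ι → ℂ) → ℂ} {U : Set (ι → ℂ)} {M : ℝ}

/-- **THE COMPLEXIFICATION CHART PRESERVES THE SUP NORM**: `‖(i ↦ (v i : ℂ))‖ = ‖v‖` on `ι → ℝ`. [folklore] -/
theorem norm_ofReal_pi (v : ι → ℝ) : ‖(fun i => (v i : ℂ))‖ = ‖v‖ := by
  simp [Pi.norm_def]

/-- **HESSIAN LETTER FOR LATTICE FIELDS, DIAGONAL**: `E ∈ C²(U)` over `ℂ` on an open `U ⊆ ι → ℂ`, `‖E‖ ≤ M` on `U`, and the closed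
polydisc of radius `δ` about the real field `x` inside `U` ⟹ `|D²(y ↦ Re E(↑y))(x)[v,v]| ≤ (2M∕δ²)‖v‖²` (sup norm). [folklore] -/
theorem abs_hessian_lattice_le (hU : IsOpen U) (hE : ContDiffOn ℂ 2 E U) (hM : ∀ q ∈ U, ‖E q‖ ≤ M) {x : ι → ℝ} {δ : ℝ}
    (hδ : 0 < δ) (hsub : closedBall (fun i => (x i : ℂ)) δ ⊆ U) (v : ι → ℝ) :
    |fderiv ℝ (fderiv ℝ (fun y : ι → ℝ => (E (fun i => (y i : ℂ))).re)) x v v| ≤ 2 * M / δ ^ 2 * ‖v‖ ^ 2 := by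
  set J : (ι → ℝ) →L[ℝ] (ι → ℂ) := ContinuousLinearMap.pi fun i => Complex.ofRealCLM.comp (ContinuousLinearMap.proj i)
    with hJ
  have hJa : ∀ y : ι → ℝ, J y = fun i => (y i : ℂ) := fun y => by ext i; simp [hJ]
  have hJn : ∀ y : ι → ℝ, ‖J y‖ = ‖y‖ := fun y => by rw [hJa, norm_ofReal_pi]
  have hP : (fun y : ι → ℝ => (E (fun i => (y i : ℂ))).re) = fun y => (E (J y)).re := by
    funext y; rw [hJa]
  rw [hP]
  exact abs_hessian_chart_le J (fun y => (hJn y).le) hU hE hM hδ (by rwa [hJa]) v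

/-- **HESSIAN LETTER FOR LATTICE FIELDS, MIXED**: `|D²(y ↦ Re E(↑y))(x)[v,w]| ≤ (4M∕δ²)‖v‖‖w‖` (sup norms). [folklore] -/
theorem abs_hessian_lattice_mixed_le (hU : IsOpen U) (hE : ContDiffOn ℂ 2 E U) (hM : ∀ q ∈ U, ‖E q‖ ≤ M) {x : ι → ℝ} {δ : ℝ}
    (hδ : 0 < δ) (hsub : closedBall (fun i => (x i : ℂ)) δ ⊆ U) (v w : ι → ℝ) :
    |fderiv ℝ (fderiv ℝ (fun y : ι → ℝ => (E (fun i => (y i : ℂ))).re)) x v w| ≤ 4 * M / δ ^ 2 * ‖v‖ * ‖w‖ := by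
  set J : (ι → ℝ) →L[ℝ] (ι → ℂ) := ContinuousLinearMap.pi fun i => Complex.ofRealCLM.comp (ContinuousLinearMap.proj i)
    with hJ
  have hJa : ∀ y : ι → ℝ, J y = fun i => (y i : ℂ) := fun y => by ext i; simp [hJ]
  have hJn : ∀ y : ι → ℝ, ‖J y‖ = ‖y‖ := fun y => by rw [hJa, norm_ofReal_pi]
  have hP : (fun y : ι → ℝ => (E (fun i => (y i : ℂ))).re) = fun y => (E (J y)).re := by
    funext y; rw [hJa]
  rw [hP]
  exact abs_hessian_chart_mixed_le J (fun y => (hJn y).le) hU hE hM hδ (by rwa [hJa]) v w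

/-- **WINDOW LETTER FOR LATTICE FIELDS**: on a real window `K ⊆ ι → ℝ` whose closed complex `δ`-polydiscs lie in `U`, the two-sided
display `−(2M∕δ²)‖v‖² ≤ iteratedFDeriv ℝ 2 (y ↦ Re E(↑y)) x ![v, v] ≤ (2M∕δ²)‖v‖²`. [folklore] -/
theorem hessianOn_lattice_twoSided (hU : IsOpen U) (hE : ContDiffOn ℂ 2 E U) (hM : ∀ q ∈ U, ‖E q‖ ≤ M) {K : Set (ι → ℝ)}
    {δ : ℝ} (hδ : 0 < δ) (hK : ∀ x ∈ K, closedBall (fun i => (x i : ℂ)) δ ⊆ U) :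
    ∀ x ∈ K, ∀ v : ι → ℝ, -(2 * M / δ ^ 2) * ‖v‖ ^ 2 ≤ iteratedFDeriv ℝ 2 (fun y : ι → ℝ => (E (fun i => (y i : ℂ))).re) x ![v, v] ∧
      iteratedFDeriv ℝ 2 (fun y : ι → ℝ => (E (fun i => (y i : ℂ))).re) x ![v, v] ≤ 2 * M / δ ^ 2 * ‖v‖ ^ 2 := by
  intro x hx v
  have h' : |iteratedFDeriv ℝ 2 (fun y : ι → ℝ => (E (fun i => (y i : ℂ))).re) x ![v, v]| ≤ 2 * M / δ ^ 2 * ‖v‖ ^ 2 := by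
    rw [iteratedFDeriv_two_apply]
    exact abs_hessian_lattice_le hU hE hM hδ (hK x hx) v
  have h := abs_le.mp h'
  constructor <;> linarith [h.1, h.2]

end Lattice

/-! ## §6 Toy: the hypotheses are jointly inhabited (`E z = z²` on `ball 0 2 ⊆ ℂ`, `M = 4`, `δ = 1`) -/

/-- Toy instance of `abs_hessian_re_le`: for `E z = z²`, holomorphic with `‖E‖ ≤ 4` on `ball 0 2`, and `δ = 1`:
`|D²(Re z²)(0)[z,z]| ≤ 8‖z‖²` (the true value is `2(Re z)² − 2(Im z)²`). [folklore] -/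
example (z : ℂ) : |fderiv ℝ (fderiv ℝ (fun q : ℂ => (q ^ 2).re)) 0 z z| ≤ 2 * 4 / 1 ^ 2 * ‖z‖ ^ 2 := by
  refine abs_hessian_re_le (E := fun q : ℂ => q ^ 2) (U := ball (0 : ℂ) 2) (M := 4) isOpen_ball
    ((contDiff_id.pow 2).contDiffOn) ?_ one_pos ?_ z
  · intro q hq
    rw [norm_pow]
    have hq' : ‖q‖ < 2 := by simpa using hq
    nlinarith [norm_nonneg q]
  · simpa using (closedBall_subset_ball (by norm_num : (1 : ℝ) < 2))

end Summit.QuantumFields.BalabanUV.T4Continuum.NE7b.AnalyticHessianLetter
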